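import Summits.Ventures.LatticeQCDFlow.Scaling.ParallelTemperingSwapKernelBalance
import Summits.Ventures.LatticeQCDFlow.Scaling.SimulatedTemperingWithinLevel
import Summits.Ventures.LatticeQCDFlow.Scaling.SimulatedTemperingComposition

/-!
HONEST FRAMING: exact (Metropolis-corrected) sampling algorithms for lattice gauge theory; figures
of merit are autocorrelation/cost numbers at stated couplings and volumes; no continuum-physics
claim.

# ParallelTemperingWithinReplica — THE WITHIN-REPLICA UPDATE OF REPLICA EXCHANGE AS A MARKOV KERNEL: RESAMPLING
# ONE REPLICA BY AN EXACT KERNEL AT ITS OWN COUPLING PRESERVES THE PRODUCT OF THE LEVEL LAWS, HENCE (WITH THE TAG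
# UNTOUCHED) THE TAGGED TARGET; SO DOES A FULL SWEEP OVER THE REPLICAS (lean-2 GEN-14, ours)

Venture-side (OURS).  Cell `lqcd-flow` (pub-lqcd), unit `pub-lqcd-lean-2-g14`, 2026-08-24.
`Scaling/ParallelTemperingAlgorithm` assembled the replica-exchange sampler from the CONSTRUCTED swap kernel and
an ABSTRACT within-replica dynamics `M` (any tag-preserving Markov kernel on the tagged space leaving
`ptTaggedTarget` invariant).  This file CONSTRUCTS that `M`: `coordUpdateKernel k M_k` resamples replica `k` from
a Markov kernel `M_k` on `Ω` (heat bath / HMC / Metropolis-corrected flow at coupling `β_k`) and keeps the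
others; if `M_k` leaves `μ_{β_k}` invariant then `coordUpdateKernel k M_k` leaves the product `⊗_j μ_{β_j}`
invariant (Fubini through Mathlib's `piFinSuccAbove` decomposition); lifted to the tagged space with the tag
untouched (`ptReplicaUpdate`, an instance of GEN-14's `stWithinLevel`) it is tag-preserving and leaves
`ptTaggedTarget` invariant; and so does the sweep `ptSweep M` updating every replica in turn.  Hence the laws of
`Scaling/ParallelTemperingAlgorithm` / `…ExactLevelLaw` hold for the fully constructed sampler
`ptSweep M ∘ₖ ptSwapKernel` with NO abstract ingredient left (corollary `ptSweep_hyps`).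

## What is defined / proved (`Ω' = Fin (K+1) → Ω`)

* §1 **`coordUpdateKernel k M_k`** `= (id ×ₖ M_k∘eval_k).map update_k` : `Kernel Ω' Ω'`;
  `coordUpdateKernel_apply` (`= (M_k (x k)).map (update x k)`), `IsMarkovKernel`;
  **`invariant_coordUpdateKernel`** — `M_k`-invariance of `μs k` ⇒ invariance of `Measure.pi μs`.
* §2 **`ptReplicaUpdate k M_k = stWithinLevel (fun _ => coordUpdateKernel k M_k)`** on the tagged space:
  Markov, tag-preserving (`ptReplicaUpdate_tagPreserving`), **`invariant_ptReplicaUpdate`** (`ptTaggedTarget`).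
* §3 `kernelChain` (composition of a finite family), `comp_tagPreserving`; **`ptSweep M`** — update replicas
  `0, …, K` in turn: Markov, tag-preserving, **`invariant_ptSweep`**; **`ptSweep_hyps`** — the pair of
  hypotheses (`hMinv`, `hM`) of every `ptScan_*` / `ptMix_*` theorem, discharged.

NOT CLAIMED: reversibility of the sweep (a deterministic-order sweep of reversible updates is not reversible;
its random-order / palindromic versions are — not typed); irreducibility.  Literature grade (cell rule):
TEXTBOOK, NEW TYPING (Mathlib `Kernel.prod`/`map`/`comap`, `measurePreserving_piFinSuccAbove`); nothing cited.
-/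

noncomputable section

open MeasureTheory ProbabilityTheory Set Filter Finset
open scoped ENNReal

namespace Summit.Ventures.LatticeQCDFlow.Scaling

/-! ## §1 Resampling one coordinate of a product -/

section Coord

variable {Ω : Type*} [MeasurableSpace Ω] {K : ℕ}

/-- **Resample coordinate `k` by the kernel `M_k`, keep the others**: `x ↦ law of update x k Y`, `Y ∼ M_k(x k, ·)`,
as a Mathlib kernel `(id ×ₖ (M_k ∘ eval_k)).map (p ↦ update p.1 k p.2)`. [ours] -/
def coordUpdateKernel (k : Fin (K + 1)) (Mk : Kernel Ω Ω) [IsMarkovKernel Mk] :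
    Kernel (Fin (K + 1) → Ω) (Fin (K + 1) → Ω) :=
  (Kernel.id ×ₖ Mk.comap (fun x : Fin (K + 1) → Ω => x k) (measurable_pi_apply k)).map
    (fun p : (Fin (K + 1) → Ω) × Ω => Function.update p.1 k p.2)

variable (k : Fin (K + 1)) (Mk : Kernel Ω Ω) [IsMarkovKernel Mk]

/-- `coordUpdateKernel k M_k x = (M_k (x k)).map (update x k)`. [ours] -/
theorem coordUpdateKernel_apply (x : Fin (K + 1) → Ω) :
    coordUpdateKernel k Mk x = (Mk (x k)).map (Function.update x k) := by
  have hg : Measurable (fun p : (Fin (K + 1) → Ω) × Ω => Function.update p.1 k p.2) := measurable_update'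
  rw [coordUpdateKernel, Kernel.map_apply _ hg, Kernel.prod_apply, Kernel.id_apply, Kernel.comap_apply,
    Measure.dirac_prod, Measure.map_map hg measurable_prodMk_left]
  rfl

/-- On a measurable set: `coordUpdateKernel k M_k x A = M_k (x k) {y | update x k y ∈ A}`. [ours] -/
theorem coordUpdateKernel_apply' (x : Fin (K + 1) → Ω) {A : Set (Fin (K + 1) → Ω)} (hA : MeasurableSet A) :
    coordUpdateKernel k Mk x A = Mk (x k) (Function.update x k ⁻¹' A) := by
  rw [coordUpdateKernel_apply, Measure.map_apply (measurable_update x) hA]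

/-- The coordinate update is Markov. [ours] -/
instance isMarkovKernel_coordUpdateKernel : IsMarkovKernel (coordUpdateKernel k Mk) := by
  unfold coordUpdateKernel
  exact Kernel.IsMarkovKernel.map _ measurable_update'

/-- **RESAMPLING ONE COORDINATE BY AN EXACT KERNEL PRESERVES THE PRODUCT**: if `M_k` leaves `μs k` invariant,
`coordUpdateKernel k M_k` leaves `Measure.pi μs` invariant (probability factors). [ours] -/
theorem invariant_coordUpdateKernel (μs : Fin (K + 1) → Measure Ω) [∀ i, IsProbabilityMeasure (μs i)]
    (hMk : Kernel.Invariant Mk (μs k)) : Kernel.Invariant (coordUpdateKernel k Mk) (Measure.pi μs) := by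
  unfold Kernel.Invariant
  refine (Measure.pi_eq (μ := μs) fun s hs => ?_).symm
  rw [Measure.bind_apply (MeasurableSet.univ_pi hs) (Kernel.aemeasurable _)]
  set e := MeasurableEquiv.piFinSuccAbove (fun _ : Fin (K + 1) => Ω) k with he_def
  have he : MeasurePreserving e.symm ((μs k).prod (Measure.pi fun j => μs (k.succAbove j))) (Measure.pi μs) :=
    (measurePreserving_piFinSuccAbove μs k).symm
  rw [← he.lintegral_comp ((coordUpdateKernel k Mk).measurable_coe (MeasurableSet.univ_pi hs))]
  -- the integrand in the coordinates `(a, r) = (x k, x ∘ succAbove)`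
  set B : Set (Fin K → Ω) := Set.univ.pi fun j => s (k.succAbove j) with hB_def
  have hBm : MeasurableSet B := MeasurableSet.univ_pi fun j => hs _
  have hx : ∀ (a : Ω) (r : Fin K → Ω) (j : Fin (K + 1)),
      e.symm (a, r) j = Fin.insertNth (α := fun _ : Fin (K + 1) => Ω) k a r j := fun a r j => by
    rw [he_def, MeasurableEquiv.piFinSuccAbove_symm_apply, Fin.insertNthEquiv_apply]
  have hF : ∀ p : Ω × (Fin K → Ω), coordUpdateKernel k Mk (e.symm p) (Set.univ.pi s) =
      Mk p.1 (s k) * B.indicator 1 p.2 := by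
    rintro ⟨a, r⟩
    rw [coordUpdateKernel_apply' k Mk _ (MeasurableSet.univ_pi hs)]
    have hxk : e.symm (a, r) k = a := by rw [hx, Fin.insertNth_apply_same]
    by_cases hr : r ∈ B
    · have hmem : e.symm (a, r) ∈ (Set.univ \ {k}).pi s := by
        intro i hi
        have hik : i ≠ k := fun h => hi.2 (by simp [h])
        obtain ⟨j, rfl⟩ := Fin.exists_succAbove_eq hik
        rw [hx, Fin.insertNth_apply_succAbove]
        exact hr j (Set.mem_univ _)
      have hset : Function.update (e.symm (a, r)) k ⁻¹' Set.univ.pi s = s k := by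
        ext y
        rw [Set.mem_preimage, Set.update_mem_pi_iff]
        simp [hmem]
      rw [hset, Set.indicator_of_mem hr, Pi.one_apply, mul_one, hxk]
    · have hnot : e.symm (a, r) ∉ (Set.univ \ {k}).pi s := by
        intro h
        apply hr
        intro j _
        have := h (k.succAbove j) ⟨Set.mem_univ _, fun h' => Fin.succAbove_ne k j (Set.mem_singleton_iff.mp h')⟩
        rwa [hx, Fin.insertNth_apply_succAbove] at this
      have hset : Function.update (e.symm (a, r)) k ⁻¹' Set.univ.pi s = ∅ := by
        ext y
        rw [Set.mem_preimage, Set.update_mem_pi_iff]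
        simp [hnot]
      rw [hset, measure_empty, Set.indicator_of_notMem hr, mul_zero]
  simp only [hF]
  have h2 : ∫⁻ p : Ω × (Fin K → Ω), Mk p.1 (s k) * B.indicator 1 p.2
      ∂((μs k).prod (Measure.pi fun j => μs (k.succAbove j))) =
      (∫⁻ a, Mk a (s k) ∂(μs k)) * ∫⁻ r, B.indicator 1 r ∂(Measure.pi fun j => μs (k.succAbove j)) :=
    lintegral_prod_mul (Mk.measurable_coe (hs k)).aemeasurable (measurable_one.indicator hBm).aemeasurable
  rw [h2, lintegral_indicator_one hBm, hB_def, Measure.pi_pi, ← Measure.bind_apply (hs k) (Kernel.aemeasurable _),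
    hMk.def, Fin.prod_univ_succAbove (fun i => μs i (s i)) k]

end Coord

/-! ## §2 The tagged within-replica update -/

section Tagged

variable {Ω : Type*} [MeasurableSpace Ω] {X : Ω → ℝ} {μ : Measure Ω} {β : ℕ → ℝ} {K : ℕ}

/-- **THE WITHIN-REPLICA UPDATE ON THE TAGGED SPACE**: resample replica `k` by `M_k`, keep the others and the tag —
GEN-14's `stWithinLevel` with the same configuration kernel at every tag value. [ours] -/
def ptReplicaUpdate (k : Fin (K + 1)) (Mk : Kernel Ω Ω) [IsMarkovKernel Mk] :
    Kernel (Fin (K + 1) × (Fin (K + 1) → Ω)) (Fin (K + 1) × (Fin (K + 1) → Ω)) :=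
  stWithinLevel fun _ : Fin (K + 1) => coordUpdateKernel k Mk

variable (k : Fin (K + 1)) (Mk : Kernel Ω Ω) [IsMarkovKernel Mk]

/-- The tagged within-replica update is Markov. [ours] -/
instance isMarkovKernel_ptReplicaUpdate : IsMarkovKernel (ptReplicaUpdate (K := K) k Mk) := by
  unfold ptReplicaUpdate; infer_instance

/-- **It preserves the tag.** [ours] -/
theorem ptReplicaUpdate_tagPreserving (y : Fin (K + 1) × (Fin (K + 1) → Ω)) :
    ptReplicaUpdate k Mk y {y' | ((y'.1 : Fin (K + 1)) : ℕ) ≠ ((y.1 : Fin (K + 1)) : ℕ)} = 0 :=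
  stWithinLevel_levelPreserving _ y

/-- **It leaves the tagged target invariant** when `M_k` leaves `μ_{β_k}` invariant (`μ` probability, `X` bounded
measurable). [ours] -/
theorem invariant_ptReplicaUpdate [IsProbabilityMeasure μ] (hXm : Measurable X) (hXb : ∃ C, ∀ x, |X x| ≤ C)
    (hMk : Kernel.Invariant Mk (μ.tilted fun x => β k * X x)) :
    Kernel.Invariant (ptReplicaUpdate k Mk) (ptTaggedTarget X μ β K) := by
  haveI : ∀ i : Fin (K + 1), IsProbabilityMeasure (μ.tilted fun x => β i * X x) := fun i =>
    isProbabilityMeasure_tilted_mul (μ := μ) hXm hXb (β i)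
  have hPi := invariant_coordUpdateKernel k Mk (fun i : Fin (K + 1) => μ.tilted fun x => β i * X x) hMk
  unfold Kernel.Invariant
  ext A hA
  rw [Measure.bind_apply hA (Kernel.aemeasurable _), lintegral_ptTaggedTarget ((ptReplicaUpdate k Mk).measurable_coe hA)]
  have h : ∀ τ : Fin (K + 1), ∫⁻ x, ptReplicaUpdate k Mk (τ, x) A
      ∂(Measure.pi fun i : Fin (K + 1) => μ.tilted fun x => β i * X x) =
      (Measure.pi fun i : Fin (K + 1) => μ.tilted fun x => β i * X x) (Prod.mk τ ⁻¹' A) := by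
    intro τ
    simp only [ptReplicaUpdate, stWithinLevel_apply' _ _ hA]
    rw [← Measure.bind_apply (measurable_prodMk_left hA) (Kernel.aemeasurable _)]
    exact congrFun (congrArg DFunLike.coe hPi.def) _
  simp only [h]
  simp only [ptTaggedTarget, Measure.smul_apply, Measure.coe_finsetSum, Finset.sum_apply,
    Measure.map_apply measurable_prodMk_left hA, smul_eq_mul]

end Tagged

/-! ## §3 A sweep over the replicas -/

section Sweep

variable {E : Type*} [MeasurableSpace E]

/-- Composition of a finite family of kernels: `kernelChain (n+1) κ = κ n ∘ₖ kernelChain n κ`,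
`kernelChain 0 κ = id`. [ours] -/
def kernelChain : (n : ℕ) → (Fin n → Kernel E E) → Kernel E E
  | 0, _ => Kernel.id
  | n + 1, κ => κ (Fin.last n) ∘ₖ kernelChain n fun i => κ (Fin.castSucc i)

/-- A chain of Markov kernels is Markov. [ours] -/
theorem isMarkovKernel_kernelChain : ∀ (n : ℕ) (κ : Fin n → Kernel E E) [∀ i, IsMarkovKernel (κ i)],
    IsMarkovKernel (kernelChain n κ)
  | 0, _, _ => by unfold kernelChain; infer_instance
  | n + 1, κ, _ => by
    haveI := isMarkovKernel_kernelChain n (fun i => κ (Fin.castSucc i))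
    unfold kernelChain; infer_instance

/-- A chain of `π`-invariant kernels is `π`-invariant. [ours] -/
theorem invariant_kernelChain {π : Measure E} : ∀ (n : ℕ) (κ : Fin n → Kernel E E),
    (∀ i, Kernel.Invariant (κ i) π) → Kernel.Invariant (kernelChain n κ) π
  | 0, _, _ => by
    unfold kernelChain Kernel.Invariant
    exact Measure.bind_dirac
  | n + 1, κ, h => by
    unfold kernelChain
    exact (h (Fin.last n)).comp (invariant_kernelChain n _ fun i => h _)

variable {lev : E → ℕ}

/-- **Composing level-preserving Markov kernels preserves the level.** [ours] -/
theorem comp_levelPreserving (hlev : Measurable lev) {M₁ M₂ : Kernel E E} [IsMarkovKernel M₂]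
    (h₁ : ∀ y, M₁ y {y' | lev y' ≠ lev y} = 0) (h₂ : ∀ y, M₂ y {y' | lev y' ≠ lev y} = 0) (y : E) :
    (M₂ ∘ₖ M₁) y {y' | lev y' ≠ lev y} = 0 := by
  have e : {y' | lev y' ≠ lev y} = lev ⁻¹' {n : ℕ | n ≠ lev y} := by ext y'; simp
  rw [e, comp_apply_levelSet (M := M₂) (κ₁ := M₁) hlev h₂, ← e, h₁ y]

/-- A chain of level-preserving Markov kernels preserves the level. [ours] -/
theorem levelPreserving_kernelChain (hlev : Measurable lev) : ∀ (n : ℕ) (κ : Fin n → Kernel E E)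
    [∀ i, IsMarkovKernel (κ i)], (∀ i y, κ i y {y' | lev y' ≠ lev y} = 0) →
    ∀ y, kernelChain n κ y {y' | lev y' ≠ lev y} = 0
  | 0, _, _, _, y => by
    unfold kernelChain
    have e : {y' | lev y' ≠ lev y} = lev ⁻¹' {n : ℕ | n ≠ lev y} := by ext y'; simp
    rw [Kernel.id_apply, e, Measure.dirac_apply' _ (hlev MeasurableSet.of_discrete)]
    simp
  | n + 1, κ, _, h, y => by
    haveI := isMarkovKernel_kernelChain n (fun i => κ (Fin.castSucc i))
    unfold kernelChain
    exact comp_levelPreserving hlev (levelPreserving_kernelChain hlev n _ (fun i => h _)) (h (Fin.last n)) y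

variable {Ω : Type*} [MeasurableSpace Ω] {X : Ω → ℝ} {μ : Measure Ω} {β : ℕ → ℝ} {K : ℕ}

/-- **THE WITHIN-REPLICA SWEEP**: update replica `0` by `M 0`, then replica `1` by `M 1`, …, replica `K` by
`M K` (each at its own coupling), tag untouched. [ours] -/
def ptSweep (M : Fin (K + 1) → Kernel Ω Ω) [∀ k, IsMarkovKernel (M k)] :
    Kernel (Fin (K + 1) × (Fin (K + 1) → Ω)) (Fin (K + 1) × (Fin (K + 1) → Ω)) :=
  kernelChain (K + 1) fun k => ptReplicaUpdate k (M k)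

variable (M : Fin (K + 1) → Kernel Ω Ω) [∀ k, IsMarkovKernel (M k)]

/-- The sweep is Markov. [ours] -/
instance isMarkovKernel_ptSweep : IsMarkovKernel (ptSweep M) := by
  unfold ptSweep; exact isMarkovKernel_kernelChain _ _

/-- **The sweep preserves the tag.** [ours] -/
theorem ptSweep_tagPreserving (y : Fin (K + 1) × (Fin (K + 1) → Ω)) :
    ptSweep M y {y' | ((y'.1 : Fin (K + 1)) : ℕ) ≠ ((y.1 : Fin (K + 1)) : ℕ)} = 0 := by
  unfold ptSweep
  exact levelPreserving_kernelChain measurable_ptLevel _ _ (fun i y => ptReplicaUpdate_tagPreserving i (M i) y) y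

/-- **THE SWEEP LEAVES THE TAGGED TARGET INVARIANT** when every `M k` leaves `μ_{β_k}` invariant (`μ` probability,
`X` bounded measurable). [ours] -/
theorem invariant_ptSweep [IsProbabilityMeasure μ] (hXm : Measurable X) (hXb : ∃ C, ∀ x, |X x| ≤ C)
    (hM : ∀ k : Fin (K + 1), Kernel.Invariant (M k) (μ.tilted fun x => β k * X x)) :
    Kernel.Invariant (ptSweep M) (ptTaggedTarget X μ β K) := by
  unfold ptSweep
  exact invariant_kernelChain _ _ fun k => invariant_ptReplicaUpdate k (M k) hXm hXb (hM k)

/-- **THE HYPOTHESES OF THE REPLICA-EXCHANGE LAWS, DISCHARGED FOR THE CONSTRUCTED SWEEP**: `ptSweep M` is a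
tag-preserving Markov kernel leaving `ptTaggedTarget` invariant, so every `ptScan_*` / `ptMix_*` theorem of
`Scaling/ParallelTemperingAlgorithm` and `Scaling/ParallelTemperingExactLevelLaw` applies to the sampler
`ptSweep M ∘ₖ ptSwapKernel` (and its random-scan version) with no abstract ingredient left. [ours] -/
theorem ptSweep_hyps [IsProbabilityMeasure μ] (hXm : Measurable X) (hXb : ∃ C, ∀ x, |X x| ≤ C)
    (hM : ∀ k : Fin (K + 1), Kernel.Invariant (M k) (μ.tilted fun x => β k * X x)) :
    Kernel.Invariant (ptSweep M) (ptTaggedTarget X μ β K) ∧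
      ∀ y, ptSweep M y {y' | ((y'.1 : Fin (K + 1)) : ℕ) ≠ ((y.1 : Fin (K + 1)) : ℕ)} = 0 :=
  ⟨invariant_ptSweep M hXm hXb hM, ptSweep_tagPreserving M⟩

end Sweep

end Summit.Ventures.LatticeQCDFlow.Scaling

end
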